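import Summits.Ventures.PercRepro.C025ProfileGirthSuccSuccFat

/-!
# THE ROW `(q, q+2)` AT GIRTH `≥ q+1` FROM A LOCAL INEQUALITY ON SINGLE SETS — THE DUAL COUNT (night-3 g20)

The thin inequality (T2′) `Σ_{|B| = q} price(B) ≤ #{clean (q+2)-sets}` follows from the inequality
  (DUAL_B)   `price(B) · C(n − q − 2, q) ≤ #{independent (q+2)-subsets of E ∖ B}`
for every `q`-subset `B`: summing, `Σ_B #{independent (q+2)-subsets of E ∖ B} = C(n − q − 2, q) · #{independent
(q+2)-sets}` (a pair `(B, U)` with `U ⊆ E ∖ B` is a pair with `B ⊆ E ∖ U`, a `(q+1+ (n−2q−2))`-set … precisely `B` ranges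
over the `q`-subsets of the `(n − q − 2)`-set `E ∖ U`), and independent sets are clean.  (DUAL_B) is a statement about
the single set `A = E ∖ B`: with `p = ρ(A)` and `m = |A|`, `C(p, 2) · C(m − 2, q) ≤ C(q+2, 2) · #{independent
(q+2)-subsets of A}` — «the density of independent `(q+2)`-sets of `A` is at least the density `C(p,2)/C(m,2)` of the
pairs inside a basis».  Own data: (DUAL_B) holds for every `q`-set of every matroid of girth `≥ q + 1` on `≤ 9` points
(q = 2: 6,851,737 sets; q = 3: 83,159; min ratio exactly 1), on direct sums of uniform matroids and free points up to
13 points, on 335 random linear matroids with planted flats and on Fano / AG(2,3) configurations (lab/dual.c, dualtest.py).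
* `sum_card_indep_sdiff_eq` — the double count;
* **`thinIneq_of_dual`** — (DUAL_B) for all `q`-subsets gives (T2′), even with the independent `(q+2)`-sets on the right;
* **`profileIneq_succ_succ_of_dual`** — (DUAL_B) gives the row `(q, q+2)` of (Π) at girth `≥ q + 1` (rank `≥ q + 3`, `q ≥ 1`).
No `def`, no `instance`, no notation.  Axioms: standard.
-/

open scoped Matroid

namespace PercRepro

open Set Finset ThmH Staged

namespace GirthRows

variable {α : Type} [DecidableEq α] {M : Matroid α} [M.Finite]

open scoped Classical in
/-- **The double count**: `Σ_{B ∈ C(E, q)} #{U ∈ C(E ∖ B, q+2) : U independent} = C(n − q − 2, q) · #{U ∈ C(E, q+2) : U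
independent}`. -/
theorem sum_card_indep_sdiff_eq (q : ℕ) :
    ∑ B ∈ (gr M).powersetCard q,
        (((gr M \ B).powersetCard (q + 2)).filter (fun U : Finset α => M.Indep (U : Set α))).card =
      ((gr M).card - q - 2).choose q *
        (((gr M).powersetCard (q + 2)).filter (fun U : Finset α => M.Indep (U : Set α))).card := by
  -- rewrite each inner count as a sum over the `(q+2)`-subsets of `E` with an indicator
  have h1 : ∀ B ∈ (gr M).powersetCard q,
      (((gr M \ B).powersetCard (q + 2)).filter (fun U : Finset α => M.Indep (U : Set α))).card =
        ∑ U ∈ ((gr M).powersetCard (q + 2)).filter (fun U : Finset α => M.Indep (U : Set α)),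
          (if Disjoint U B then 1 else 0) := by
    intro B hB
    rw [Finset.sum_boole]
    simp only [Nat.cast_id]
    congr 1
    ext U
    simp only [Finset.mem_filter, Finset.mem_powersetCard]
    constructor
    · rintro ⟨⟨hUg, hUc⟩, hUi⟩
      refine ⟨⟨⟨hUg.trans Finset.sdiff_subset, hUc⟩, hUi⟩, ?_⟩
      rw [Finset.disjoint_left]
      intro x hxU hxB
      exact (Finset.mem_sdiff.1 (hUg hxU)).2 hxB
    · rintro ⟨⟨⟨hUg, hUc⟩, hUi⟩, hd⟩
      refine ⟨⟨?_, hUc⟩, hUi⟩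
      intro x hx
      rw [Finset.mem_sdiff]
      exact ⟨hUg hx, Finset.disjoint_left.1 hd hx⟩
  rw [Finset.sum_congr rfl h1, Finset.sum_comm]
  -- for each independent `U`, the `q`-subsets `B` of `E` disjoint from `U` are the `q`-subsets of `E ∖ U`
  have h2 : ∀ U ∈ ((gr M).powersetCard (q + 2)).filter (fun U : Finset α => M.Indep (U : Set α)),
      ∑ B ∈ (gr M).powersetCard q, (if Disjoint U B then 1 else 0) = ((gr M).card - q - 2).choose q := by
    intro U hU
    rw [Finset.mem_filter, Finset.mem_powersetCard] at hU
    rw [Finset.sum_boole]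
    simp only [Nat.cast_id]
    have : ((gr M).powersetCard q).filter (fun B => Disjoint U B) = (gr M \ U).powersetCard q := by
      ext B
      simp only [Finset.mem_filter, Finset.mem_powersetCard]
      constructor
      · rintro ⟨⟨hBg, hBc⟩, hd⟩
        refine ⟨?_, hBc⟩
        intro x hx
        rw [Finset.mem_sdiff]
        exact ⟨hBg hx, fun hxU => Finset.disjoint_left.1 hd hxU hx⟩
      · rintro ⟨hBg, hBc⟩
        refine ⟨⟨hBg.trans Finset.sdiff_subset, hBc⟩, ?_⟩
        rw [Finset.disjoint_left]
        intro x hxU hxB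
        exact (Finset.mem_sdiff.1 (hBg hxB)).2 hxU
    rw [this, Finset.card_powersetCard, Finset.card_sdiff_of_subset hU.1.1, hU.1.2]
    rfl
  rw [Finset.sum_congr rfl h2, Finset.sum_const, smul_eq_mul, mul_comm]

open scoped Classical in
/-- **(T2′) FROM THE LOCAL DUAL INEQUALITY**: if every `q`-subset `B` satisfies
`price(B) · C(n − q − 2, q) ≤ #{independent (q+2)-subsets of E ∖ B}`, then
`Σ_{B ∈ Rq, #B = q} price(B) ≤ #{independent (q+2)-sets} ≤ #{clean (q+2)-sets}`. -/
theorem thinIneq_of_dual {q : ℕ}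
    (hdual : ∀ B ∈ (gr M).powersetCard q,
      Profile.price M q (q + 2) B * (((gr M).card - q - 2).choose q : ℚ) ≤
        ((((gr M \ B).powersetCard (q + 2)).filter (fun U : Finset α => M.Indep (U : Set α))).card : ℚ)) :
    ∑ B ∈ (Profile.Rq M q).filter (fun B : Finset α => B.card = q), Profile.price M q (q + 2) B ≤
      ((((gr M).powersetCard (q + 2)).filter
        (fun U : Finset α => ∀ X ⊆ U, X.card = q + 1 → M.Indep (X : Set α))).card : ℚ) := by
  -- step 0: the thin members of `Rq` are `q`-subsets of `E`
  have hsub : (Profile.Rq M q).filter (fun B : Finset α => B.card = q) ⊆ (gr M).powersetCard q := by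
    intro B hB
    rw [Finset.mem_filter, Profile.mem_Rq] at hB
    rw [Finset.mem_powersetCard]
    exact ⟨hB.1.1, hB.2⟩
  have h0 : ∑ B ∈ (Profile.Rq M q).filter (fun B : Finset α => B.card = q), Profile.price M q (q + 2) B ≤
      ∑ B ∈ (gr M).powersetCard q, Profile.price M q (q + 2) B :=
    Finset.sum_le_sum_of_subset_of_nonneg hsub (fun B _ _ => Profile.price_nonneg _ _ _)
  -- step 1: independent `(q+2)`-sets are clean
  have hclean : ((((gr M).powersetCard (q + 2)).filter (fun U : Finset α => M.Indep (U : Set α))).card : ℚ) ≤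
      ((((gr M).powersetCard (q + 2)).filter
        (fun U : Finset α => ∀ X ⊆ U, X.card = q + 1 → M.Indep (X : Set α))).card : ℚ) := by
    apply Nat.cast_le.2
    apply Finset.card_le_card
    intro U hU
    rw [Finset.mem_filter] at hU ⊢
    exact ⟨hU.1, clean_of_indep hU.2⟩
  -- step 2: the case `C(n − q − 2, q) = 0`: every price is `0` (then `|E ∖ B| < q + 2`)
  by_cases hC : ((gr M).card - q - 2).choose q = 0
  · have hz : ∀ B ∈ (gr M).powersetCard q, Profile.price M q (q + 2) B = 0 := by
      intro B hB
      rw [Finset.mem_powersetCard] at hB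
      have hlt : (gr M).card - q - 2 < q := Nat.choose_eq_zero_iff.1 hC
      unfold Profile.price
      rw [if_neg]
      intro hthr
      have h1 : ((q + 2 : ℕ) : ℕ∞) ≤ ((gr M \ B).card : ℕ∞) := by
        refine hthr.trans ?_
        rw [← Set.encard_coe_eq_coe_finsetCard]
        exact M.eRk_le_encard _
      have h2 : q + 2 ≤ (gr M \ B).card := by exact_mod_cast h1
      rw [Finset.card_sdiff_of_subset hB.1, hB.2] at h2
      omega
    calc ∑ B ∈ (Profile.Rq M q).filter (fun B : Finset α => B.card = q), Profile.price M q (q + 2) B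
        ≤ ∑ B ∈ (gr M).powersetCard q, Profile.price M q (q + 2) B := h0
      _ = 0 := Finset.sum_eq_zero hz
      _ ≤ _ := Nat.cast_nonneg _
  · have hCpos : (0 : ℚ) < (((gr M).card - q - 2).choose q : ℕ) := by
      exact_mod_cast Nat.pos_of_ne_zero hC
    -- step 3: divide the dual inequality and sum
    have h3 : ∑ B ∈ (gr M).powersetCard q, Profile.price M q (q + 2) B ≤
        ∑ B ∈ (gr M).powersetCard q,
          ((((gr M \ B).powersetCard (q + 2)).filter (fun U : Finset α => M.Indep (U : Set α))).card : ℚ) /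
            (((gr M).card - q - 2).choose q : ℚ) := by
      apply Finset.sum_le_sum
      intro B hB
      rw [le_div_iff₀ hCpos]
      exact hdual B hB
    have h4 : ∑ B ∈ (gr M).powersetCard q,
          ((((gr M \ B).powersetCard (q + 2)).filter (fun U : Finset α => M.Indep (U : Set α))).card : ℚ) /
            (((gr M).card - q - 2).choose q : ℚ) =
        ((((gr M).powersetCard (q + 2)).filter (fun U : Finset α => M.Indep (U : Set α))).card : ℚ) := by
      rw [← Finset.sum_div]
      rw [div_eq_iff hCpos.ne']
      have := sum_card_indep_sdiff_eq (M := M) q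
      have h' : ((∑ B ∈ (gr M).powersetCard q,
          (((gr M \ B).powersetCard (q + 2)).filter (fun U : Finset α => M.Indep (U : Set α))).card : ℕ) : ℚ) =
          ((((gr M).card - q - 2).choose q *
            (((gr M).powersetCard (q + 2)).filter (fun U : Finset α => M.Indep (U : Set α))).card : ℕ) : ℚ) := by
        rw [this]
      push_cast at h'
      rw [h']
      ring
    calc ∑ B ∈ (Profile.Rq M q).filter (fun B : Finset α => B.card = q), Profile.price M q (q + 2) B
        ≤ ∑ B ∈ (gr M).powersetCard q, Profile.price M q (q + 2) B := h0
      _ ≤ _ := h3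
      _ = _ := h4
      _ ≤ _ := hclean

open scoped Classical in
/-- **THE ROW `(q, q+2)` OF (Π) AT GIRTH `≥ q + 1` FROM THE LOCAL DUAL INEQUALITY** (rank `≥ q + 3`, `q ≥ 1`). -/
theorem profileIneq_succ_succ_of_dual {q : ℕ} (hq : 1 ≤ q) (hg : ∀ T ⊆ M.E, T.encard ≤ q → M.Indep T)
    (hrank : ((q + 3 : ℕ) : ℕ∞) ≤ M.eRank)
    (hdual : ∀ B ∈ (gr M).powersetCard q,
      Profile.price M q (q + 2) B * (((gr M).card - q - 2).choose q : ℚ) ≤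
        ((((gr M \ B).powersetCard (q + 2)).filter (fun U : Finset α => M.Indep (U : Set α))).card : ℚ)) :
    Profile.ProfileIneq M q (q + 2) :=
  profileIneq_succ_succ_of_thin hq hg hrank (thinIneq_of_dual hdual)

end GirthRows

end PercRepro
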